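import Summits.CriticalPhenomena.CardyFormulaZ2.Theorems.CardyBoundaryCoulombGasHalfPlaneMarkDensityLawDensitySubseq
import Summits.CriticalPhenomena.CardyFormulaZ2.Theorems.CardyBoundaryCoulombGasHalfPlaneMarkDensityLawReduction

/-!
# `HalfPlaneMarkDensityLaw` (crux stmt-CriticalPhenomena-5661), line `Sketch`:
# REGULARITY OF THE MARK DENSITY along CDF-convergent subsequences (lead c4-0)

The crux is a statement about the lattice mark density of critical bond percolation on `ℤ²`,
`lawSeq a b c x n = n · P_{1/2}[E_n(a,b,c,x)]` (`E_n` = "`⌊xn⌋` is the `c`-most boundary vertex of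
`[⌊cn⌋,∞)` joined in `ℤ×ℕ` to `[⌊an⌋,⌊bn⌋]×{0}`"), whereas everything landed so far about
subsequential scaling limits concerns the CDF `P_n(a,b,c,y) = P_{1/2}[A_n ↔ [⌊cn⌋,⌊yn⌋]×{0}]`
(`…SubsequentialLimits`, `…Identification`).  This file transfers the subsequential theory to the
density, unconditionally:

* `lawSeq_bounded` — the crux's sequence is BOUNDED: eventually `0 ≤ lawSeq a b c x n ≤ B(a,b,c,x)`;
* `densityRegularity` (registered extra stub `stub_densityRegularity`) — for `c < x₀ ≤ x₁` there is
  `C = C(a,b,c,x₀,x₁) ≥ 0` such that: whenever the CDF converges along some `θ → ∞` to `G` on a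
  window `(x−δ₀, x+δ₀) ⊆ [x₀,x₁]`, the density converges ALONG THE SAME SUBSEQUENCE,
  `lawSeq a b c x (θ j) → ρ`, the limit CDF is differentiable at `x` with `G'(x) = ρ` and second-order
  one-sided Taylor bounds `|G(x±t) − G(x) ∓ ρt| ≤ C t²`, and two such limits `ρ, ρ'` at `x, x'` satisfy
  `|ρ' − ρ| ≤ C |x' − x|`;
* `tendsto_lawSeq_and_hasDerivAt` — the pointwise corollary.

Inputs: the `n⁻²`-Lipschitz bound of the line (`shiftLipschitz`, stub L: two-arm point bound,
four-case inclusion, independence), exact telescoping (`window_sum_eq`), and the pure-analysis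
subsequential difference-quotient lemma (`…DensitySubseq`).  Consequences for joint subsequential
limits and the crux (every joint limit is `C^{1,1}` in the fourth mark with derivative the density
limit; crux `⟺` that derivative is Cardy's density) are in the companion file `…DensityIdentification`.
-/

noncomputable section

namespace Summit.CriticalPhenomena.CardyFormulaZ2.Cruxes.HalfPlaneMarkDensityLaw.SketchLine

open Literature.Probability.Percolation Literature.Probability.LatticeModels
open MeasureTheory Filter Set
open scoped Topology
open Summit.CriticalPhenomena.CardyFormulaZ2.Theorems.HalfPlaneMarkDensityLaw.Negative

namespace Density

/-! ### The lattice data of the crux in the form of the analysis lemmas -/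

/-- The crux's sequence in `firstHit` form: `lawSeq a b c x n = n · P[E(⌊xn⌋)]` with
`E(k) = firstHit halfPlane A_n ⌊cn⌋ k` (definitional). [folklore] -/
theorem lawSeq_eq (a b c x : ℝ) (n : ℕ) :
    lawSeq a b c x n = (n : ℝ) * μ.real (firstHit halfPlane (arcA a b n) ⌊c * n⌋ ⌊x * n⌋) := rfl

/-- The crux's sequence is nonnegative. [folklore] -/
theorem lawSeq_nonneg (a b c x : ℝ) (n : ℕ) : 0 ≤ lawSeq a b c x n :=
  mul_nonneg (Nat.cast_nonneg n) measureReal_nonneg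

/-- Exact telescoping in the window form of the analysis lemmas: for `c < x − δ₀` and
`x − δ₀ ≤ y ≤ y'`, `Σ_{⌊yn⌋ < k ≤ ⌊y'n⌋} P[E(k)] = P_n(y') − P_n(y)`. [folklore] -/
theorem windowSums (a b c : ℝ) {x δ₀ : ℝ} (hcx : c < x - δ₀) :
    ∀ n : ℕ, ∀ y y' : ℝ, x - δ₀ ≤ y → y ≤ y' → y' ≤ x + δ₀ →
      ∑ i ∈ Finset.range (⌊y' * n⌋ - ⌊y * n⌋).toNat,
          μ.real (firstHit halfPlane (arcA a b n) ⌊c * n⌋ (⌊y * n⌋ + 1 + i)) =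
        μ.real (openCrossing halfPlane (arcA a b n) (rowIcc ⌊c * n⌋ ⌊y' * n⌋)) -
          μ.real (openCrossing halfPlane (arcA a b n) (rowIcc ⌊c * n⌋ ⌊y * n⌋)) :=
  fun n y y' hy hyy' _ ↦ window_sum_eq a b c y y' (by linarith) hyy' n

/-- The `n⁻²`-Lipschitz bound of the line (`shiftLipschitz`) with a NONNEGATIVE constant on the lattice
window `[⌊x₀n⌋, ⌊x₁n⌋]`, `c < x₀ ≤ x₁`. [folklore] -/
theorem exists_lipschitz_nonneg {a b c x₀ x₁ : ℝ} (hab : a < b) (hbc : b < c) (hcx : c < x₀)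
    (hx : x₀ ≤ x₁) :
    ∃ C : ℝ, 0 ≤ C ∧ ∀ n : ℕ, 1 ≤ n → ∀ k k' : ℤ, ⌊x₀ * n⌋ ≤ k → k ≤ k' → k' ≤ ⌊x₁ * n⌋ →
      |μ.real (firstHit halfPlane (arcA a b n) ⌊c * n⌋ k') -
          μ.real (firstHit halfPlane (arcA a b n) ⌊c * n⌋ k)| ≤ C * (k' - k) / (n : ℝ) ^ 2 := by
  obtain ⟨C, hC⟩ := shiftLipschitz a b c x₀ x₁ hab hbc hcx hx
  refine ⟨max C 0, le_max_right _ _, fun n hn k k' h1 h2 h3 ↦ (hC n hn k k' h1 h2 h3).trans ?_⟩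
  have hkk : (k : ℝ) ≤ k' := by exact_mod_cast h2
  rw [mul_div_assoc, mul_div_assoc]
  exact mul_le_mul_of_nonneg_right (le_max_left _ _) (div_nonneg (sub_nonneg.2 hkk) (by positivity))

/-! ### Boundedness of the crux's sequence -/

/-- **The crux's sequence is bounded**: for `a < b < c < x` there is `B` with
`lawSeq a b c x n ≤ B` eventually (window estimate with `t = (x−c)/2`; the only percolation input is
the Lipschitz constant, i.e. the half-plane two-arm point bound). [folklore] -/
theorem lawSeq_bounded {a b c x : ℝ} (hab : a < b) (hbc : b < c) (hcx : c < x) :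
    ∃ B : ℝ, ∀ᶠ n : ℕ in atTop, lawSeq a b c x n ≤ B := by
  set δ₀ : ℝ := (x - c) / 2 with hδ₀
  have hδ₀0 : 0 < δ₀ := by rw [hδ₀]; linarith
  have hcx' : c < x - δ₀ := by rw [hδ₀]; linarith
  obtain ⟨C, hC0, hC⟩ := exists_lipschitz_nonneg hab hbc hcx' (by linarith : x - δ₀ ≤ x + δ₀)
  refine ⟨2 / δ₀ + 2 * C * δ₀, ?_⟩
  have h := eventually_abs_pointMass_le
    (g := fun n k ↦ μ.real (firstHit halfPlane (arcA a b n) ⌊c * n⌋ k))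
    (P := fun n y ↦ μ.real (openCrossing halfPlane (arcA a b n) (rowIcc ⌊c * n⌋ ⌊y * n⌋)))
    hC0 hδ₀0.le (windowSums a b c hcx') hC (fun n y ↦ ⟨measureReal_nonneg, measureReal_le_one⟩)
    hδ₀0 le_rfl
  filter_upwards [h] with n hn
  rw [lawSeq_eq]
  exact (le_abs_self _).trans hn

/-! ### Density regularity along CDF-convergent subsequences -/

/-- **Density regularity (registered extra stub `stub_densityRegularity` of line `Sketch`).** For
`a < b < c < x₀ ≤ x₁` there is `C ≥ 0` such that for every window `(x−δ₀, x+δ₀) ⊆ [x₀, x₁]`, every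
`θ → ∞` and every `G : ℝ → ℝ` with `P_{θ j}(a,b,c,y) → G y` for all `y ∈ (x−δ₀, x+δ₀)`:
the crux's sequence converges along `θ`, `lawSeq a b c x (θ j) → ρ`; `G` is differentiable at `x`
with derivative `ρ`; `|G(x+t) − G x − ρt| ≤ Ct²` and `|G x − G(x−t) − ρt| ≤ Ct²` for `0 < t < δ₀`;
and limits `ρ, ρ'` of the crux's sequences at two points `x, x' ∈ [x₀,x₁]` along the same `θ`
satisfy `|ρ' − ρ| ≤ C|x' − x|`. [folklore] -/
theorem densityRegularity {a b c x₀ x₁ : ℝ} (hab : a < b) (hbc : b < c) (hcx₀ : c < x₀)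
    (hx₀₁ : x₀ ≤ x₁) :
    ∃ C : ℝ, 0 ≤ C ∧
      (∀ (x δ₀ : ℝ), 0 < δ₀ → x₀ ≤ x - δ₀ → x + δ₀ ≤ x₁ →
        ∀ θ : ℕ → ℕ, Tendsto θ atTop atTop → ∀ G : ℝ → ℝ,
          (∀ y : ℝ, x - δ₀ < y → y < x + δ₀ →
            Tendsto (fun j ↦ μ.real (openCrossing halfPlane (arcA a b (θ j))
              (rowIcc ⌊c * (θ j : ℕ)⌋ ⌊y * (θ j : ℕ)⌋))) atTop (𝓝 (G y))) →
          ∃ ρ : ℝ, Tendsto (fun j ↦ lawSeq a b c x (θ j)) atTop (𝓝 ρ) ∧ HasDerivAt G ρ x ∧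
            (∀ t : ℝ, 0 < t → t < δ₀ → |G (x + t) - G x - ρ * t| ≤ C * t ^ 2) ∧
            (∀ t : ℝ, 0 < t → t < δ₀ → |G x - G (x - t) - ρ * t| ≤ C * t ^ 2)) ∧
      (∀ θ : ℕ → ℕ, Tendsto θ atTop atTop → ∀ x x' ρ ρ' : ℝ, x₀ ≤ x → x ≤ x₁ → x₀ ≤ x' → x' ≤ x₁ →
        Tendsto (fun j ↦ lawSeq a b c x (θ j)) atTop (𝓝 ρ) →
        Tendsto (fun j ↦ lawSeq a b c x' (θ j)) atTop (𝓝 ρ') → |ρ' - ρ| ≤ C * |x' - x|) := by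
  obtain ⟨C, hC0, hC⟩ := exists_lipschitz_nonneg hab hbc hcx₀ hx₀₁
  refine ⟨C, hC0, fun x δ₀ hδ₀ hlo hhi θ hθ G hG ↦ ?_, fun θ hθ x x' ρ ρ' h₀ h₁ h₀' h₁' hρ hρ' ↦ ?_⟩
  · -- Taylor part: the subsequential difference-quotient lemma
    have hcx : c < x - δ₀ := by linarith
    have hlip : ∀ n : ℕ, 1 ≤ n → ∀ k k' : ℤ, ⌊(x - δ₀) * n⌋ ≤ k → k ≤ k' → k' ≤ ⌊(x + δ₀) * n⌋ →
        |μ.real (firstHit halfPlane (arcA a b n) ⌊c * n⌋ k') -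
            μ.real (firstHit halfPlane (arcA a b n) ⌊c * n⌋ k)| ≤ C * (k' - k) / (n : ℝ) ^ 2 := by
      intro n hn k k' h1 h2 h3
      have hlo' : ⌊x₀ * (n : ℝ)⌋ ≤ ⌊(x - δ₀) * n⌋ :=
        Int.floor_le_floor (mul_le_mul_of_nonneg_right hlo (Nat.cast_nonneg _))
      have hhi' : ⌊(x + δ₀) * (n : ℝ)⌋ ≤ ⌊x₁ * n⌋ :=
        Int.floor_le_floor (mul_le_mul_of_nonneg_right hhi (Nat.cast_nonneg _))
      exact hC n hn k k' (hlo'.trans h1) h2 (h3.trans hhi')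
    obtain ⟨ρ, hρ, hD, hR, hL⟩ := tendsto_pointMass_and_hasDerivAt
      (g := fun n k ↦ μ.real (firstHit halfPlane (arcA a b n) ⌊c * n⌋ k))
      (P := fun n y ↦ μ.real (openCrossing halfPlane (arcA a b n) (rowIcc ⌊c * n⌋ ⌊y * n⌋)))
      (G := G) hC0 hδ₀ (windowSums a b c hcx) hlip hθ hG
    exact ⟨ρ, hρ, hD, hR, hL⟩
  · -- Lipschitz part: limits at two points
    refine abs_sub_le_of_pointMass
      (g := fun n k ↦ μ.real (firstHit halfPlane (arcA a b n) ⌊c * n⌋ k)) hθ ?_ hρ hρ'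
    filter_upwards [eventually_ge_atTop 1] with n hn
    rcases le_total x x' with hxx' | hxx'
    · have hfl : ⌊x * (n : ℝ)⌋ ≤ ⌊x' * n⌋ :=
        Int.floor_le_floor (mul_le_mul_of_nonneg_right hxx' (Nat.cast_nonneg _))
      have h := hC n hn ⌊x * n⌋ ⌊x' * n⌋
        (Int.floor_le_floor (mul_le_mul_of_nonneg_right h₀ (Nat.cast_nonneg _))) hfl
        (Int.floor_le_floor (mul_le_mul_of_nonneg_right h₁' (Nat.cast_nonneg _)))
      have habs : |((⌊x' * (n : ℝ)⌋ - ⌊x * (n : ℝ)⌋ : ℤ) : ℝ)| = ((⌊x' * (n : ℝ)⌋ : ℝ) - ⌊x * (n : ℝ)⌋) := by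
        push_cast
        exact abs_of_nonneg (by exact_mod_cast sub_nonneg.2 hfl)
      rw [habs]
      exact h
    · have hfl : ⌊x' * (n : ℝ)⌋ ≤ ⌊x * n⌋ :=
        Int.floor_le_floor (mul_le_mul_of_nonneg_right hxx' (Nat.cast_nonneg _))
      have h := hC n hn ⌊x' * n⌋ ⌊x * n⌋
        (Int.floor_le_floor (mul_le_mul_of_nonneg_right h₀' (Nat.cast_nonneg _))) hfl
        (Int.floor_le_floor (mul_le_mul_of_nonneg_right h₁ (Nat.cast_nonneg _)))
      have habs : |((⌊x' * (n : ℝ)⌋ - ⌊x * (n : ℝ)⌋ : ℤ) : ℝ)| = ((⌊x * (n : ℝ)⌋ : ℝ) - ⌊x' * (n : ℝ)⌋) := by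
        push_cast
        rw [abs_sub_comm]
        exact abs_of_nonneg (by exact_mod_cast sub_nonneg.2 hfl)
      rw [habs, abs_sub_comm]
      exact h

/-- **Registered extra stub of line `Sketch` (lead c4-0): density regularity**, the closed form of
`densityRegularity`. [folklore] -/
theorem stub_densityRegularity :
    ∀ a b c x₀ x₁ : ℝ, a < b → b < c → c < x₀ → x₀ ≤ x₁ →
    ∃ C : ℝ, 0 ≤ C ∧
      (∀ (x δ₀ : ℝ), 0 < δ₀ → x₀ ≤ x - δ₀ → x + δ₀ ≤ x₁ →
        ∀ θ : ℕ → ℕ, Tendsto θ atTop atTop → ∀ G : ℝ → ℝ,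
          (∀ y : ℝ, x - δ₀ < y → y < x + δ₀ →
            Tendsto (fun j ↦ μ.real (openCrossing halfPlane (arcA a b (θ j))
              (rowIcc ⌊c * (θ j : ℕ)⌋ ⌊y * (θ j : ℕ)⌋))) atTop (𝓝 (G y))) →
          ∃ ρ : ℝ, Tendsto (fun j ↦ lawSeq a b c x (θ j)) atTop (𝓝 ρ) ∧ HasDerivAt G ρ x ∧
            (∀ t : ℝ, 0 < t → t < δ₀ → |G (x + t) - G x - ρ * t| ≤ C * t ^ 2) ∧
            (∀ t : ℝ, 0 < t → t < δ₀ → |G x - G (x - t) - ρ * t| ≤ C * t ^ 2)) ∧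
      (∀ θ : ℕ → ℕ, Tendsto θ atTop atTop → ∀ x x' ρ ρ' : ℝ, x₀ ≤ x → x ≤ x₁ → x₀ ≤ x' → x' ≤ x₁ →
        Tendsto (fun j ↦ lawSeq a b c x (θ j)) atTop (𝓝 ρ) →
        Tendsto (fun j ↦ lawSeq a b c x' (θ j)) atTop (𝓝 ρ') → |ρ' - ρ| ≤ C * |x' - x|) :=
  fun _ _ _ _ _ hab hbc hcx₀ hx₀₁ ↦ densityRegularity hab hbc hcx₀ hx₀₁

/-- **Pointwise corollary.** If the CDF `P_{θ j}(a,b,c,·)` converges on `(x−δ₀, x+δ₀)` (`c < x−δ₀`)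
to `G` along some `θ → ∞`, then the crux's sequence converges along `θ` to a number `ρ`, and `G` is
differentiable at `x` with `G'(x) = ρ`. [folklore] -/
theorem tendsto_lawSeq_and_hasDerivAt {a b c x δ₀ : ℝ} (hab : a < b) (hbc : b < c) (hδ₀ : 0 < δ₀)
    (hcx : c < x - δ₀) {θ : ℕ → ℕ} (hθ : Tendsto θ atTop atTop) {G : ℝ → ℝ}
    (hG : ∀ y : ℝ, x - δ₀ < y → y < x + δ₀ →
      Tendsto (fun j ↦ μ.real (openCrossing halfPlane (arcA a b (θ j))
        (rowIcc ⌊c * (θ j : ℕ)⌋ ⌊y * (θ j : ℕ)⌋))) atTop (𝓝 (G y))) :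
    ∃ ρ : ℝ, Tendsto (fun j ↦ lawSeq a b c x (θ j)) atTop (𝓝 ρ) ∧ HasDerivAt G ρ x := by
  obtain ⟨C, -, hT, -⟩ := densityRegularity hab hbc hcx (by linarith : x - δ₀ ≤ x + δ₀)
  obtain ⟨ρ, hρ, hD, -, -⟩ := hT x δ₀ hδ₀ le_rfl le_rfl θ hθ G hG
  exact ⟨ρ, hρ, hD⟩

end Density

end Summit.CriticalPhenomena.CardyFormulaZ2.Cruxes.HalfPlaneMarkDensityLaw.SketchLine
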